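import Summits.Langlands.Langlands.Statement
import Literature.NumberTheory.Automorphic.IsobaricRigidityRepData
import Literature.NumberTheory.Automorphic.PairLFunctionPolesRepDataOfHumphriesJo
import HarnessLib

/-!
# SKELETON — line `split-x1-isobaric-rigidity` for the crux `ReciprocityUpToIrreducibility` (item stmt-Langlands-14328;
routes OrdinaryPrimeTransport / IrreducibilityBySelfDuality), crux-strategist planner-cstrat-stmt-Langlands-14328-r1-0

Plan for piece X₁ `IsobaricRigidityGLn` (support; child of the split `directional-split`): a THEOREM in print
(Jacquet–Shalika 1981 II, Thm. 4.4, read at unramified places for Borel–Jacquet representation data), proved in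
the tree as `CuspidalAutomorphicRepData.not_eventually_satake_eq_sum_of_JS` modulo the two accepted Literature
texts Arthur–Clozel Ch. 3 (2.2) (`JacquetShalika1981_partialPairL_boundary_repData` — non-vanishing of partial
pair L-functions on Re s = 1, = IrreducibilityBySelfDuality's input item PairLBoundaryJS stmt-Langlands-13622) and
(2.3) (pole at s = 1 iff contragredient pair), the latter reduced in the tree to Humphries–Jo 2024 in ranks ≥ 3
(`JacquetShalika1981_partialPairL_pole_repData_of_humphriesJo_three_le`).  So the two stubs are PUBLISHED
THEOREMS' accepted texts, worked by the Literature queue (the `JacquetShalika1981_partialPairL_pole_*` reduction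
files; ranks ≤ 2 done).  Composition `IsobaricRigidityGLn_of` = the landed K4.  Stubs are the ONLY sorries.
-/

noncomputable section
set_option linter.dupNamespace false

namespace Summit.Langlands.Langlands.Cruxes.ReciprocityUpToIrreducibility.SplitX1

open scoped NumberField Classical Polynomial BigOperators
open Filter IsDedekindDomain Polynomial
open Literature.NumberTheory.Automorphic Literature.NumberTheory.GaloisRepresentations
open Summit.Langlands

/-- Piece X₁, verbatim as filed. -/
def IsobaricRigidityGLn : Prop :=
  ∀ (K : Type) [Field K] [NumberField K] (n : ℕ) (hcpt : Literature.NumberTheory.Automorphic.isCompact_glFiniteIntegralLevel n K) (π : Literature.NumberTheory.Automorphic.CuspidalAutomorphicRepData n K hcpt) (k : ℕ) (m : Fin k → ℕ) (hm : ∀ i, Literature.NumberTheory.Automorphic.isCompact_glFiniteIntegralLevel (m i) K) (σ : ∀ i, Literature.NumberTheory.Automorphic.CuspidalAutomorphicRepData (m i) K (hm i)), 0 < n → 2 ≤ k → (∀ i, 0 < m i) → ¬ ∀ᶠ v : IsDedekindDomain.HeightOneSpectrum (NumberField.RingOfIntegers K) in Filter.cofinite, ∀ α : Multiset ℂ, π.1.HasSatakeParamAt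 v α → ∃ β : Fin k → Multiset ℂ, (∀ i, (σ i).1.HasSatakeParamAt v (β i)) ∧ α = ∑ i, β i

/-- **AC (2.2) for Borel–Jacquet data (named Literature text; = item stmt-Langlands-13622 `PairLBoundaryJS` verbatim)**: non-vanishing of the partial Rankin–Selberg L-function of a unitary cuspidal pair on Re s = 1. [cite: JacquetShalikaAJM1981, Thm. 5.3] [cite: ArthurClozelAMS120, Ch. 3 §2 (2.2)] -/
theorem stub_jsBoundary :
    JacquetShalika1981_partialPairL_boundary_repData := by
  sorry

/-- **Humphries–Jo 2024 Thm 1.1/5.6 in ranks ≥ 3 (named Literature text)** — archimedean Rankin–Selberg test vectors; ALL that AC (2.3) for Borel–Jacquet data still rests on in the tree. [cite: HumphriesJo2024, Thm. 1.1, Thm. 5.6] -/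
theorem stub_humphriesJo_three_le :
    ∀ (N : ℕ) (K : Type) [Field K] [NumberField K], 3 ≤ N → HumphriesJo2024_archRankinSelberg_testVector N K := by
  sorry

/-- AC (2.3) for Borel–Jacquet data from the Humphries–Jo stub (tree theorem). -/
theorem jsPole_of_stub : JacquetShalika1981_partialPairL_pole_repData :=
  JacquetShalika1981_partialPairL_pole_repData_of_humphriesJo_three_le stub_humphriesJo_three_le

/-- **COMPOSITION — piece X₁ from the two stubs** (Jacquet–Shalika II Thm 4.4 at unramified places =
`CuspidalAutomorphicRepData.not_eventually_satake_eq_sum_of_JS`). -/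
theorem IsobaricRigidityGLn_of : IsobaricRigidityGLn :=
  fun K _ _ n hcpt π k m hm σ hn hk hm0 =>
    CuspidalAutomorphicRepData.not_eventually_satake_eq_sum_of_JS stub_jsBoundary jsPole_of_stub π σ hn hk hm0

end Summit.Langlands.Langlands.Cruxes.ReciprocityUpToIrreducibility.SplitX1

end
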